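import Mathlib
import Summits.Ventures.HodgeRepro.Tier4.Common.AdelicDefs
import Summits.Ventures.HodgeRepro.Tier4.Common.CongruenceAdeles
import Summits.Ventures.HodgeRepro.Tier4.Common.CompactOpenLevel
import Summits.Ventures.HodgeRepro.Tier4.Line4.LevelCosetCongruence

/-!
# Tier4/Line4/BlockDetCongruence — a `2×2` block determinant passes the level congruence

Blind re-derivation cell `pub-hodge-repro`, Tier 4 «prove the step» (README §9–§10), seat t4-L1-p3 (gen 4).
Tree path `lean/Summits/Ventures/HodgeRepro/Tier4/Line4/BlockDetCongruence.lean`.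

The level congruence of LevelCosetCongruence is ENTRYWISE: `κ g κ' ≡ g (mod N)` for `κ, κ' ∈ K(N)`.  A `T × T′`-invariant
of the orbit is a POLYNOMIAL in the entries (the norm `N_{E/k}` of the `(0,0)` `E`-entry is the determinant of the
`2×2` block `[[x, −n y], [y, x + t y]]` of the regular representation); this file records that the determinant of the
top-left `2×2` block of a `4×4` adelic matrix — and, by the same four-term identity, of ANY `2×2` block `(i₀ i₁) × (j₀ j₁)` —
passes the congruence: `A ≡ A₀ (mod N)` entrywise with `A, A₀` finite-integral ⇒ `blockDet A ≡ blockDet A₀ (mod N)`,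
and for rational matrices the difference is `N` times an integer of `k`.

Identity used: `a d − b c − (a₀ d₀ − b₀ c₀) = (a − a₀) d + a₀ (d − d₀) − ((b − b₀) c + b₀ (c − c₀))`, each product being
(congruence) × (integral) or (integral) × (congruence) — LevelCosetCongruence's (A2)/(A2′).
No printed input.  HC_CM is NOT proved by anyone in this repository.
-/

namespace Summit.Ventures.HodgeRepro.Tier4.Line4

open Summit.Ventures.HodgeRepro.Tier4.Common NumberField Matrix
open scoped NumberField

section BlockDet

variable {k : Type} [Field k] [NumberField k]

/-- The determinant of the `2×2` block of `A` on rows `i₀, i₁` and columns `j₀, j₁`. -/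
noncomputable def blockDet (A : M4 k) (i₀ i₁ j₀ j₁ : Fin 4) : Ad k :=
  A i₀ j₀ * A i₁ j₁ - A i₀ j₁ * A i₁ j₀

/-- The four-term identity behind the congruence. -/
theorem blockDet_sub_eq (A A₀ : M4 k) (i₀ i₁ j₀ j₁ : Fin 4) :
    blockDet A i₀ i₁ j₀ j₁ - blockDet A₀ i₀ i₁ j₀ j₁ =
      ((A - A₀) i₀ j₀ * A i₁ j₁ + A₀ i₀ j₀ * (A - A₀) i₁ j₁) -
        ((A - A₀) i₀ j₁ * A i₁ j₀ + A₀ i₀ j₁ * (A - A₀) i₁ j₀) := by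
  simp only [blockDet, Matrix.sub_apply]
  ring

/-- **A `2×2` block determinant passes the level congruence**: `A ≡ A₀ (mod N)` entrywise, `A` and `A₀` finite-integral
⇒ `blockDet A ≡ blockDet A₀ (mod N)`. -/
theorem blockDet_sub_mem_congrSet {N : ℕ} {A A₀ : M4 k} (hA : IsIntegralFinMat A) (hA₀ : IsIntegralFinMat A₀)
    (h : ∀ i j, (A - A₀) i j ∈ congrSet k N) (i₀ i₁ j₀ j₁ : Fin 4) :
    blockDet A i₀ i₁ j₀ j₁ - blockDet A₀ i₀ i₁ j₀ j₁ ∈ congrSet k N := by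
  rw [blockDet_sub_eq]
  refine (congrSet k N).sub_mem ((congrSet k N).add_mem ?_ ?_) ((congrSet k N).add_mem ?_ ?_)
  · exact mul_mem_congrSet_of_integral k (h i₀ j₀) (hA i₁ j₁)
  · exact mul_mem_congrSet_of_integral' k (hA₀ i₀ j₀) (h i₁ j₁)
  · exact mul_mem_congrSet_of_integral k (h i₀ j₁) (hA i₁ j₀)
  · exact mul_mem_congrSet_of_integral' k (hA₀ i₀ j₁) (h i₁ j₀)

/-- The block determinant of a rational matrix is the principal adele of the `k`-block determinant. -/
theorem blockDet_map_algebraMap (m : Matrix (Fin 4) (Fin 4) k) (i₀ i₁ j₀ j₁ : Fin 4) :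
    blockDet (m.map (algebraMap k (Ad k))) i₀ i₁ j₀ j₁ =
      algebraMap k (Ad k) (m i₀ j₀ * m i₁ j₁ - m i₀ j₁ * m i₁ j₀) := by
  simp only [blockDet, Matrix.map_apply, map_sub, map_mul]

end BlockDet

section Coset

variable {k : Type} [Field k] [NumberField k] (W : PlaneData k)

/-- A finite-integral `g` and `κ, κ' ∈ K(N)` give a finite-integral `κ g κ'`. -/
theorem isIntegralFin_mul_of_mem_levelK {N : ℕ} {κ κ' g : GA W} (hκ : κ ∈ levelK W N) (hκ' : κ' ∈ levelK W N)
    (hg : IsIntegralFin W g) : IsIntegralFin W (κ * g * κ') := by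
  have hA₁ : IsCongr k N (GA.mat W κ) := ((mem_levelK W N κ).mp hκ).1
  have hA : IsCongr k N (GA.mat W κ') := ((mem_levelK W N κ').mp hκ').1
  have hmat : GA.mat W (κ * g * κ') = GA.mat W κ * GA.mat W g * GA.mat W κ' := by
    simp [GA.mat, Subgroup.coe_mul, Units.val_mul]
  unfold IsIntegralFin
  rw [hmat]
  exact ((IsIntegralFinMat.of_isCongr hA₁).mul hg).mul (IsIntegralFinMat.of_isCongr hA)

/-- **The block determinant on a level double coset**: for `κ, κ' ∈ K(N)` and finite-integral `g`,
`blockDet (κ g κ') ≡ blockDet g (mod N)`. -/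
theorem blockDet_sub_mem_congrSet_of_mem_levelK {N : ℕ} {κ κ' g : GA W} (hκ : κ ∈ levelK W N)
    (hκ' : κ' ∈ levelK W N) (hg : IsIntegralFin W g) (i₀ i₁ j₀ j₁ : Fin 4) :
    blockDet (GA.mat W (κ * g * κ')) i₀ i₁ j₀ j₁ - blockDet (GA.mat W g) i₀ i₁ j₀ j₁ ∈ congrSet k N :=
  blockDet_sub_mem_congrSet (isIntegralFin_mul_of_mem_levelK W hκ hκ' hg) hg
    (fun i j => mat_sub_mem_congrSet_of_mem_levelK W hκ hκ' hg i j) i₀ i₁ j₀ j₁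

/-- **THE SPARSE COSET FOR A BLOCK DETERMINANT IN `k`**: for rational `γ = κ γ₀ κ'` (`κ, κ' ∈ K(N)`, `γ₀` rational
finite-integral, `N ≠ 0`), the `k`-matrices `m, m₀` of `γ, γ₀` have block determinants differing by `N` times an
integer of `k`. -/
theorem blockDet_sub_eq_N_mul_of_mem_levelK_mul {N : ℕ} (hN : N ≠ 0) {κ κ' γ₀ : GA W} (hκ : κ ∈ levelK W N)
    (hκ' : κ' ∈ levelK W N) (hγ₀ : γ₀ ∈ rationalPoints W) (hint : IsIntegralFin W γ₀)
    (hγ : κ * γ₀ * κ' ∈ rationalPoints W) (i₀ i₁ j₀ j₁ : Fin 4) :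
    ∃ m m₀ : Matrix (Fin 4) (Fin 4) k, GA.mat W (κ * γ₀ * κ') = m.map (algebraMap k (Ad k)) ∧
      GA.mat W γ₀ = m₀.map (algebraMap k (Ad k)) ∧
      ∃ z : 𝓞 k, (m i₀ j₀ * m i₁ j₁ - m i₀ j₁ * m i₁ j₀) - (m₀ i₀ j₀ * m₀ i₁ j₁ - m₀ i₀ j₁ * m₀ i₁ j₀) =
        (N : k) * algebraMap (𝓞 k) k z := by
  obtain ⟨m, hm⟩ := exists_rational_mat_of_mem_rationalPoints W hγ
  obtain ⟨m₀, hm₀⟩ := exists_rational_mat_of_mem_rationalPoints W hγ₀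
  refine ⟨m, m₀, hm, hm₀, ?_⟩
  have hc := blockDet_sub_mem_congrSet_of_mem_levelK W hκ hκ' hint i₀ i₁ j₀ j₁
  rw [hm, hm₀, blockDet_map_algebraMap, blockDet_map_algebraMap, ← map_sub] at hc
  exact exists_eq_N_mul_of_algebraMap_mem_congrSet hN hc

end Coset

end Summit.Ventures.HodgeRepro.Tier4.Line4
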